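import Summits.QuantumFields.YangMills.Theorems.BalabanUVNodesN06AtRecord11ObligationsSectB
import Literature.MathematicalPhysics.QuantumFieldTheory.Balaban1983to89.B9SectBStepFrameV2

/-!
# BalabanUVNodes ∕ N06 ([B9], `Dag.B9_main`) — THE SECT.-B OBLIGATION `hB` OF THE STAGE-11 CERTIFICATE AT THE RECORD FROM ONE
# LETTERS DICTIONARY `SectBFrame₂` (row 13 in one instantiation, FRAMES V2 — the inhabitable contract)

Track A of `YM-PLAN.md` (cell `pub-ymgap`, HUMAN RULING D-0062), node **N06** = [Balaban1985BackgroundPropagators] Thms 3.1–3.15;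
seat `pub-ymgap-dag-n06-c` gen 4 (N06-ASSIGNMENT row 13 `hB`).  The v2 twin of `BalabanUVNodesN06SectBOfFrame` (gen 3): there row 13
was knit from ONE binder `F : B9SectBGStepAtLettersMore.SectBFrame …` — a frame this seat then found UNINHABITABLE over the record
family (LOCATED-4: its [4] Lemma-2.1 fields copy r06's «for every 0 < α < 1, no M-threshold» hypothesis shape, false over a family with
unboundedly many scales; and its kernel-form laws `ker31` ∕ `kerG` ∕ `kerGp` are not satisfied by Bałaban's own propagators on
multi-point blocks for d ≥ 3, lit-balaban desk ME #13).  The repair is the Literature-side chain `B9Thm34SectBUniformR1` ∕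
`B9Thm34GUniformR1` ∕ `B9Thm34HolderGpUniformR1` (r06's uniform theorems with the Lemma-2.1 inputs asked only for the exponents
`9/5000 ≦ α` the proofs use), `B9SectBGpStepAtLettersV2` ∕ `B9SectBGStepAtLettersV2` (frames v2: Lemma-2.1 fields M-thresholded by
print's (2.59) and rate-capped) and the honest capstone `B9SectBStepFrameV2.SectBFrame₂` (the ten kernel-free steps framed; the
twelve (3.46) L² member-steps and the three G-side Hölder steps DISPLAYED verbatim as positive-input steps — print's own Sect.-B statement
for those members).

WHAT THIS MODULE DOES (kernel bookkeeping BY NAME; 0 `def`, 0 `sorry`, standard axioms; COUNT-NEUTRAL, `--supports` K1′ as helper):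
* `hB_obligation_of_sectBFrame₂` — `hB` AT THE RECORD (`I := MemberY`, dimension `θ₃.d₆ + 1`, `c35Y`, `geo9Y`, `bg9Y (M_N ℂ) SU(N)`,
  the layer's `Gp ∕ GA ∕ Cinv ∕ IsAnalyticExt`) from ONE `F : SectBFrame₂ …` over the layer's families with `F.dB = θ₃.d₆ + 1`, and the
  leaf's Theorems 3.2 ∕ 3.3 (`B9.Thm32Printed`, `B9.Thm33Printed` — at the record `B9.thm32_of_thm39 … t39 hksum` and
  `B9.thm33_of_thm37_310 … t37 t310 hsum` from the certificate's own binders); the sign schema is DISCHARGED by dag-n03-b's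
  `modelSignsOn_geo9K`.  Drop-in replacement for `N06SectBOfFrame.hB_obligation_of_sectBFrame` in the N06 certificate
  (`…N06AtOpsYOfRecord`, p487053): same conclusion, binder `F : SectBFrame₂ …` instead of `F : SectBFrame …`.

HONEST FRAMING.  `F` is a HYPOTHESIS: no `SectBFrame₂` over the record's operator layer exists in the tree yet (its letters are NODE
00 def-Y's `lettersYOfRecord`; its two Lemma-2.1 fields are dischargeable from `rowSum261_geo9Y` ∕ `ineq260_geo9K` above
M-thresholds; its five displayed step fields (fifteen member-steps) are Sect.-B CONTENT of [B9] for the L² and G-Hölder members, not in the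
tree); k stays
0 ∕ 28 in the referee's sense; N06 is NOT discharged.  One finite four-torus programme at fixed `ε` — NOT ℝ⁴, NOT OS, NOT a mass
gap, NOT Clay.  No `def`.
-/

noncomputable section

namespace Summit.QuantumFields.YangMills.BalabanUVNodes.N06SectBOfFrameV2

open Literature.MathematicalPhysics.QuantumFieldTheory.Balaban1983to89
open Literature.MathematicalPhysics.QuantumFieldTheory.Balaban1983to89.Node00
open Literature.MathematicalPhysics.QuantumFieldTheory.Balaban1983to89.B9PinMembersKLevelV1 (MemberY geo9Y bg9Y)
open Literature.MathematicalPhysics.QuantumFieldTheory.Balaban1983to89.B9PinGeometryKLevelV1 (c35Y)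
open Literature.MathematicalPhysics.QuantumFieldTheory.Balaban1983to89.B7Prop2SpecialUnitary (specialUnitaryUnits)
open Literature.MathematicalPhysics.QuantumFieldTheory.Balaban1983to89.B9GeoNormsKLevelModelSignsV1 (modelSignsOn_geo9K)
open Literature.MathematicalPhysics.QuantumFieldTheory.Balaban1983to89.B9SectBStepFrameV2 (SectBFrame₂ sectBStepPrinted_of_sectBFrame₂)
open scoped Matrix.Norms.L2Operator

variable {N : ℕ}

/-- **THE `hB` OBLIGATION OF THE CERTIFICATE AT THE RECORD'S [B9] BUNDLE FROM ONE SECT.-B LETTERS DICTIONARY (V2)** (Sect. B pp. 400–407;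
Theorem 3.4 p. 400 «The extended operators satisfy all the inequalities of Theorems 3.1–3.3 correspondingly»; p. 407 «Thus
Theorem 3.4 is proved, assuming that Theorems 3.1–3.3 hold»): given a `SectBFrame₂` over the layer's kernel families (real
coordinates `b` of `M_N(ℂ)`, directions `κ`, fine-lattice carriers `S x`) whose dimension field is the record's `θ₃.d₆ + 1`, and the
leaf's Theorems 3.2 ∕ 3.3, the Sect.-B obligation `hB` of `N06AtRecord11CB10YZW.b9_main_of_up_view₁₁B10YZW_of_obligations` holds —
`B9SectBStepFrameV2.sectBStepPrinted_of_sectBFrame₂` with the sign schema `modelSignsOn_geo9K x.toKIdx`.  `F` is a hypothesis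
(no instance in the tree; unlike v1's `SectBFrame` it is inhabitable over the record family by design); nothing of print asserted.
[cite: Balaban1985BackgroundPropagators, Thm 3.4 p.400 + Sect. B (3.50)–(3.86) pp.400–407 + Thms 3.1–3.3 pp.397–399 + (3.39)–(3.41) p.397] -/
theorem hB_obligation_of_sectBFrame₂ (θ₃ : Stage3Params) (Mstar : ℕ) (ops : OpsY N θ₃ Mstar)
    [∀ x : MemberY θ₃.d₆ θ₃.ℓ₆ θ₃.hd' θ₃.hL' θ₃.b₀ θ₃.b₁ Mstar, Fintype (geo9Y x).Site]
    [∀ x : MemberY θ₃.d₆ θ₃.ℓ₆ θ₃.hd' θ₃.hL' θ₃.b₀ θ₃.b₁ Mstar, DecidableEq (geo9Y x).Site]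
    [∀ x : MemberY θ₃.d₆ θ₃.ℓ₆ θ₃.hd' θ₃.hL' θ₃.b₀ θ₃.b₁ Mstar, Nonempty (geo9Y x).Site]
    {ι κ : Type} [Fintype ι] [DecidableEq ι] [Fintype κ] [LinearOrder κ] (b : Module.Basis ι ℝ (Matrix (Fin N) (Fin N) ℂ))
    (S : MemberY θ₃.d₆ θ₃.ℓ₆ θ₃.hd' θ₃.hL' θ₃.b₀ θ₃.b₁ Mstar → Type) [∀ x, Fintype (S x)] [∀ x, DecidableEq (S x)]
    (F : SectBFrame₂ c35Y geo9Y (bg9Y (Matrix (Fin N) (Fin N) ℂ) (specialUnitaryUnits (Fin N))) (fun x => (ops x).Gp) b κ S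
      (fun x => (ops x).GA) (fun x => (ops x).Cinv) (fun x => (ops x).IsAnalyticExt))
    (hd : F.dB = θ₃.d₆ + 1)
    (h32 : B9.Thm32Printed (θ₃.d₆ + 1) c35Y geo9Y (bg9Y (Matrix (Fin N) (Fin N) ℂ) (specialUnitaryUnits (Fin N))) (fun x => (ops x).Cinv))
    (h33 : B9.Thm33Printed c35Y geo9Y (bg9Y (Matrix (Fin N) (Fin N) ℂ) (specialUnitaryUnits (Fin N))) (fun x => (ops x).Gp)
      (fun x => (ops x).GA)) :
    B9.SectBStepPrinted (θ₃.d₆ + 1) c35Y geo9Y (bg9Y (Matrix (Fin N) (Fin N) ℂ) (specialUnitaryUnits (Fin N))) (fun x => (ops x).Gp)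
      (fun x => (ops x).GA) (fun x => (ops x).Cinv) (fun x => (ops x).IsAnalyticExt) := by
  rw [← hd] at h32 ⊢
  exact sectBStepPrinted_of_sectBFrame₂ F (P := fun _ lam => lam.isRight = true) (fun x => modelSignsOn_geo9K x.toKIdx) h32 h33

end Summit.QuantumFields.YangMills.BalabanUVNodes.N06SectBOfFrameV2
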